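import Literature.AnabelianGeometry.SemiGraphs.PSCVertCountConnectivity
import Literature.AnabelianGeometry.SemiGraphs.PSCTwoComponentShape
import Literature.GroupTheory.CombinatorialGroupTheory.PuncturedSurfaceGroupZeroFourBases
import HarnessLib

/-!
# [CombGC] Rmk. 1.1.3 `i(G_U) ≤ n(G_U) + 1` at the genuine MULTI-VERTEX shapes: two-component and two-tripod data

Mochizuki, *A combinatorial version of the Grothendieck conjecture* [CombGC] §1, Def. 1.1 (i) p. 6,
Rmk. 1.1.3 p. 8 [cite: MochizukiCombGC2007, Rmk 1.1.3 p.8]; [IUTchI] Rmk. 1.2.3 (i) p. 41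
[cite: Mochizuki2012, IUTchI Rmk 1.2.3(i) p.41].  Sequel of `PSCVertCountConnectivity.lean` (the
criterion `vertCountLeNodeCountSucc_of_generate` / `_of_twoVertex`: tree-aligned representatives +
topological generation ⇒ the coset graphs of all coverings are connected ⇒ `i(G_U) ≤ n(G_U) + 1`).
PROOF-ONLY (no definitions).  The sub-node row F-3810 `PSCDatum.VertCountLeNodeCountSucc`
(abc-iut-w4-d052, `PSCGraphicitySub.lean`) — a displayed input of every [CombGC] Thm. 1.6 kernel of the
tree, false over the bare interface (abc-iut-w5-d057's two-point datum) — HOLDS at the two genuine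
multi-vertex shapes the cell has in the kernel:

* `vertCountLeNodeCountSucc_of_twoComponent` — TWO-COMPONENT shape (abc-iut-f-165,
  `PSCTwoComponentShape.lean`; a stable curve with two proper smooth components of genera `g₁, g₂`
  meeting at one node): along a pro-`Σ` completion `ι : Γ_{g₁+g₂,0} → Π`, `Π_{v₀}`, `Π_{v₁}` the closures
  of the two handle groups, every node group the closure of the vanishing cycle `z = ∏_{i<g₁}[a_i,b_i]`;
  `z` lies in the first handle group and — being `(∏_j [a_{g₁+j},b_{g₁+j}])⁻¹` by the relator
  (`prod_comm_castAdd_mul_prod_comm_natAdd`) — in the second, and the handles generate `Γ_{g₁+g₂,0}`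
  (`closure_handles_castAdd_sup_closure_handles_natAdd`).
* `vertCountLeNodeCountSucc_of_twoTripod` — TWO-TRIPOD shape (abc-iut-L5-t6, `PSCTwoTripodOrigin.lean`;
  the 4-pointed line degenerated into two tripods): `Π_{v₁} = closure ι⟨b₀,b₁⟩`,
  `Π_{v₂} = closure ι⟨b₁,b₂⟩`, node groups `closure ι⟨b₁⟩` for a free basis `b` of `Γ_{0,4}`; a free basis
  generates.

Instance / consistency evidence for the typed schema at genuine data; not the printed statement for all
pointed stable curves; nothing here takes a side on [IUTchIII] Cor. 3.12.
-/

noncomputable section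

namespace Literature.AnabelianGeometry.SemiGraphs

universe u

namespace PSCDatum

open scoped Pointwise
open Literature.GroupTheory.CombinatorialGroupTheory
open SemiGraphOfAnabelioids (IsProSigmaCompletion)

/-! ### Generation lemmas in the discrete groups -/

/-- The handle generators `a_i, b_i` (`i < g₁` or `i ≥ g₁`) generate `Γ_{g₁+g₂,0}`: the join of the two
handle subgroups is everything. [cite: MochizukiSemiAnbd2006, Ex. 2.10 p.31] -/
theorem closure_handles_castAdd_sup_closure_handles_natAdd (g₁ g₂ : ℕ) :
    Subgroup.closure
        (Set.range (fun i : Fin g₁ => PuncturedSurfaceGroup.a (g := g₁ + g₂) (r := 0) (Fin.castAdd g₂ i)) ∪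
          Set.range (fun i : Fin g₁ => PuncturedSurfaceGroup.b (g := g₁ + g₂) (r := 0) (Fin.castAdd g₂ i))) ⊔
      Subgroup.closure
        (Set.range (fun j : Fin g₂ => PuncturedSurfaceGroup.a (g := g₁ + g₂) (r := 0) (Fin.natAdd g₁ j)) ∪
          Set.range (fun j : Fin g₂ => PuncturedSurfaceGroup.b (g := g₁ + g₂) (r := 0) (Fin.natAdd g₁ j))) =
      ⊤ := by
  classical
  rw [eq_top_iff, ← Subgroup.closure_union]
  -- every generator of the presented group lies in the union of the four handle families
  have hgen := PresentedGroup.closure_range_of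
    ({PuncturedSurfaceGroup.relator (g₁ + g₂) 0} : Set (FreeGroup (puncturedSurfaceGen (g₁ + g₂) 0)))
  refine (ge_of_eq hgen).trans ((Subgroup.closure_le _).mpr ?_)
  rintro _ ⟨y, rfl⟩
  refine Subgroup.subset_closure ?_
  rcases y with ⟨k, bb⟩ | j
  · -- a handle generator: split `k : Fin (g₁ + g₂)` as `castAdd` / `natAdd`
    induction k using Fin.addCases with
    | left i =>
      refine Or.inl ?_
      cases bb
      · exact Or.inl ⟨i, rfl⟩
      · exact Or.inr ⟨i, rfl⟩
    | right j =>
      refine Or.inr ?_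
      cases bb
      · exact Or.inl ⟨j, rfl⟩
      · exact Or.inr ⟨j, rfl⟩
  · exact j.elim0

-- adapted from `Literature/GroupTheory/CombinatorialGroupTheory/OneRelatorModPrimeHomologyFaithful.lean`
/-- A free basis generates. [folklore] -/
private theorem closure_range_basis_eq_top {ι Γ : Type*} [Group Γ] (b : FreeGroupBasis ι Γ) :
    Subgroup.closure (Set.range b) = ⊤ := by
  rw [eq_top_iff]
  intro x _
  have hx : b.repr x ∈ Subgroup.closure (Set.range (FreeGroup.of : ι → FreeGroup ι)) := by
    rw [FreeGroup.closure_range_of]; exact Subgroup.mem_top _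
  have := Subgroup.mem_map_of_mem (b.repr.symm : FreeGroup ι →* Γ) hx
  rw [MonoidHom.map_closure, ← Set.range_comp] at this
  have hrange : ((b.repr.symm : FreeGroup ι →* Γ) ∘ FreeGroup.of) = ⇑b := rfl
  rw [hrange] at this
  simpa using this

variable {P : Type u} [Group P] [TopologicalSpace P] [IsTopologicalGroup P]

/-! ### Data of two-component shape (abc-iut-f-165) -/

section TwoComponent

variable {g₁ g₂ : ℕ}

/-- **Two-component shape: `i(G_U) ≤ n(G_U) + 1`.**  For a datum of TWO-COMPONENT SHAPE — vertices
`v₀, v₁` only, `Π_{v₀}`, `Π_{v₁}` the closures of the two handle groups along a pro-`Σ` completion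
`ι : Γ_{g₁+g₂,0} → Π` (any `Σ`), every node group the closure of the vanishing cycle `∏_{i<g₁}[a_i,b_i]`,
and at least one node — every covering `G_U` has `i(G_U) ≤ n(G_U) + 1`: the vanishing cycle lies in the
first handle group and, being `(∏_{j}[a_{g₁+j},b_{g₁+j}])⁻¹` by the relator, in the second (tree-aligned
representatives), and the handles generate `Γ_{g₁+g₂,0}`, whose image is dense.  First MULTI-VERTEX
instance of the sub-node row F-3810 at proper (cusp-free) components. [cite: MochizukiCombGC2007, Rmk 1.1.3 p.8] -/
theorem vertCountLeNodeCountSucc_of_twoComponent [CompactSpace P] (G : PSCDatum P) {S : Set ℕ}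
    (ι : PuncturedSurfaceGroup (g₁ + g₂) 0 →* P) (hι : IsProSigmaCompletion S ι)
    (v₀ v₁ : G.graph.V) (hV : ∀ w, w = v₀ ∨ w = v₁) (e₀ : G.graph.N)
    (hV₀ : G.vertGp v₀ = ((Subgroup.closure
      (Set.range (fun i : Fin g₁ => PuncturedSurfaceGroup.a (r := 0) (Fin.castAdd g₂ i)) ∪
        Set.range (fun i : Fin g₁ => PuncturedSurfaceGroup.b (r := 0) (Fin.castAdd g₂ i)))).map
          ι).topologicalClosure)
    (hV₁ : G.vertGp v₁ = ((Subgroup.closure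
      (Set.range (fun j : Fin g₂ => PuncturedSurfaceGroup.a (r := 0) (Fin.natAdd g₁ j)) ∪
        Set.range (fun j : Fin g₂ => PuncturedSurfaceGroup.b (r := 0) (Fin.natAdd g₁ j)))).map
          ι).topologicalClosure)
    (hN : ∀ e, G.nodeGp e = ((Subgroup.zpowers (List.ofFn fun i : Fin g₁ =>
      PuncturedSurfaceGroup.a (g := g₁ + g₂) (r := 0) (Fin.castAdd g₂ i) *
        PuncturedSurfaceGroup.b (Fin.castAdd g₂ i) * (PuncturedSurfaceGroup.a (Fin.castAdd g₂ i))⁻¹ *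
          (PuncturedSurfaceGroup.b (Fin.castAdd g₂ i))⁻¹).prod).map ι).topologicalClosure) :
    G.VertCountLeNodeCountSucc := by
  classical
  -- the vanishing cycle and its mirror
  set z : PuncturedSurfaceGroup (g₁ + g₂) 0 := (List.ofFn fun i : Fin g₁ =>
      PuncturedSurfaceGroup.a (g := g₁ + g₂) (r := 0) (Fin.castAdd g₂ i) *
        PuncturedSurfaceGroup.b (Fin.castAdd g₂ i) * (PuncturedSurfaceGroup.a (Fin.castAdd g₂ i))⁻¹ *
          (PuncturedSurfaceGroup.b (Fin.castAdd g₂ i))⁻¹).prod with hz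
  set z' : PuncturedSurfaceGroup (g₁ + g₂) 0 := (List.ofFn fun j : Fin g₂ =>
      PuncturedSurfaceGroup.a (g := g₁ + g₂) (r := 0) (Fin.natAdd g₁ j) *
        PuncturedSurfaceGroup.b (Fin.natAdd g₁ j) * (PuncturedSurfaceGroup.a (Fin.natAdd g₁ j))⁻¹ *
          (PuncturedSurfaceGroup.b (Fin.natAdd g₁ j))⁻¹).prod with hz'
  set H₀ : Subgroup (PuncturedSurfaceGroup (g₁ + g₂) 0) := Subgroup.closure
      (Set.range (fun i : Fin g₁ => PuncturedSurfaceGroup.a (g := g₁ + g₂) (r := 0) (Fin.castAdd g₂ i)) ∪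
        Set.range (fun i : Fin g₁ => PuncturedSurfaceGroup.b (g := g₁ + g₂) (r := 0) (Fin.castAdd g₂ i)))
    with hH₀
  set H₁ : Subgroup (PuncturedSurfaceGroup (g₁ + g₂) 0) := Subgroup.closure
      (Set.range (fun j : Fin g₂ => PuncturedSurfaceGroup.a (g := g₁ + g₂) (r := 0) (Fin.natAdd g₁ j)) ∪
        Set.range (fun j : Fin g₂ => PuncturedSurfaceGroup.b (g := g₁ + g₂) (r := 0) (Fin.natAdd g₁ j)))
    with hH₁
  -- a product of commutators of listed generators lies in the subgroup they generate
  have hprod : ∀ {m : ℕ} (f : Fin m → Fin (g₁ + g₂)) (H : Subgroup (PuncturedSurfaceGroup (g₁ + g₂) 0)),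
      (∀ k, PuncturedSurfaceGroup.a (g := g₁ + g₂) (r := 0) (f k) ∈ H) →
      (∀ k, PuncturedSurfaceGroup.b (g := g₁ + g₂) (r := 0) (f k) ∈ H) →
      (List.ofFn fun k : Fin m => PuncturedSurfaceGroup.a (g := g₁ + g₂) (r := 0) (f k) *
        PuncturedSurfaceGroup.b (f k) * (PuncturedSurfaceGroup.a (f k))⁻¹ *
          (PuncturedSurfaceGroup.b (f k))⁻¹).prod ∈ H := by
    intro m f H ha hb
    refine Subgroup.list_prod_mem _ fun y hy => ?_
    rw [List.mem_ofFn] at hy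
    obtain ⟨k, rfl⟩ := hy
    exact H.mul_mem (H.mul_mem (H.mul_mem (ha k) (hb k)) (H.inv_mem (ha k))) (H.inv_mem (hb k))
  -- `z ∈ H₀`; `z' ∈ H₁`, so `z = z'⁻¹ ∈ H₁` by the relator `z * z' = 1`
  have hz₀ : z ∈ H₀ := hprod _ H₀ (fun i => Subgroup.subset_closure (Or.inl ⟨i, rfl⟩))
    (fun i => Subgroup.subset_closure (Or.inr ⟨i, rfl⟩))
  have hz₁ : z ∈ H₁ := by
    have hrel : z * z' = 1 := PuncturedSurfaceGroup.prod_comm_castAdd_mul_prod_comm_natAdd g₁ g₂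
    rw [eq_inv_of_mul_eq_one_left hrel]
    exact H₁.inv_mem (hprod _ H₁ (fun j => Subgroup.subset_closure (Or.inl ⟨j, rfl⟩))
      (fun j => Subgroup.subset_closure (Or.inr ⟨j, rfl⟩)))
  have hle : ∀ (H : Subgroup (PuncturedSurfaceGroup (g₁ + g₂) 0)), z ∈ H →
      ((Subgroup.zpowers z).map ι).topologicalClosure ≤ (H.map ι).topologicalClosure := fun H hzH =>
    Subgroup.topologicalClosure_mono (Subgroup.map_mono ((Subgroup.zpowers_le).mpr hzH))
  refine vertCountLeNodeCountSucc_of_twoVertex G v₀ v₁ hV e₀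
    (fun e => ⟨by rw [hN e, hV₀]; exact hle H₀ hz₀, by rw [hN e, hV₁]; exact hle H₁ hz₁⟩) ?_
  rw [hV₀, hV₁]
  exact topologicalClosure_sup_eq_top_of_dense ι hι.dense
    (closure_handles_castAdd_sup_closure_handles_natAdd g₁ g₂)

end TwoComponent

/-! ### Data of two-tripod shape (abc-iut-L5-t6) -/

/-- **Two-tripod shape: `i(G_U) ≤ n(G_U) + 1`.**  For a datum of TWO-TRIPOD SHAPE (abc-iut-L5-t6's
`PSCTwoTripodOrigin.lean`: `Π_{v₁} = closure ι⟨b₀, b₁⟩`, `Π_{v₂} = closure ι⟨b₁, b₂⟩`, every node group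
`closure ι⟨b₁⟩`, for a free basis `b` of `Γ_{0,4}` along a pro-`Σ` completion `ι : Γ_{0,4} → Π`; any
cusp groups) with at least one node, every covering `G_U` has `i(G_U) ≤ n(G_U) + 1` — the first
multi-vertex instance of F-3810 at AFFINE data. [cite: MochizukiCombGC2007, Rmk 1.1.3 p.8] -/
theorem vertCountLeNodeCountSucc_of_twoTripod [CompactSpace P] (G : PSCDatum P) {S : Set ℕ}
    (ι : PuncturedSurfaceGroup 0 4 →* P) (hι : IsProSigmaCompletion S ι)
    (b : FreeGroupBasis (Fin 3) (PuncturedSurfaceGroup 0 4)) (v₁ v₂ : G.graph.V)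
    (hV : ∀ v, v = v₁ ∨ v = v₂) (e₀ : G.graph.N)
    (hV₁ : G.vertGp v₁ = ((Subgroup.closure (b '' {0, 1})).map ι).topologicalClosure)
    (hV₂ : G.vertGp v₂ = ((Subgroup.closure (b '' {1, 2})).map ι).topologicalClosure)
    (hN : ∀ e, G.nodeGp e = ((Subgroup.closure (b '' {1})).map ι).topologicalClosure) :
    G.VertCountLeNodeCountSucc := by
  have hle : ∀ S : Set (Fin 3), (1 : Fin 3) ∈ S →
      ((Subgroup.closure (b '' {1})).map ι).topologicalClosure ≤
        ((Subgroup.closure (b '' S)).map ι).topologicalClosure := fun S hS =>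
    Subgroup.topologicalClosure_mono (Subgroup.map_mono (Subgroup.closure_mono
      (Set.image_mono (Set.singleton_subset_iff.mpr hS))))
  refine vertCountLeNodeCountSucc_of_twoVertex G v₁ v₂ hV e₀
    (fun e => ⟨by rw [hN e, hV₁]; exact hle _ (by simp), by rw [hN e, hV₂]; exact hle _ (by simp)⟩) ?_
  rw [hV₁, hV₂]
  refine topologicalClosure_sup_eq_top_of_dense ι hι.dense ?_
  rw [← Subgroup.closure_union, ← Set.image_union, eq_top_iff, ← closure_range_basis_eq_top b]
  refine Subgroup.closure_mono ?_
  rintro _ ⟨k, rfl⟩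
  refine ⟨k, ?_, rfl⟩
  fin_cases k <;> simp

end PSCDatum

end Literature.AnabelianGeometry.SemiGraphs

end
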